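import Mathlib
import HarnessLib
import Summits.QuantumFields.YangMills.Theorems.HypercubicLimit.Negative.ReflectedDensity
import Summits.QuantumFields.YangMills.Theorems.FradkinShenkerFlowFiniteSusceptibilityWeakCouplingRPCauchySchwarz
import Summits.QuantumFields.YangMills.Theorems.LangevinControlUVOSLegsFromFemtoAndGapStubAssemblyLatticeDist
import Summits.QuantumFields.YangMills.Theorems.LangevinControlUVOSLegsFromFemtoAndGapStubAssemblyShiftDefect
import Summits.QuantumFields.YangMills.Theorems.LangevinControlUVOSLegsFromFemtoAndGapStubUpgrade
import Literature.MathematicalPhysics.AQFT.OSAxiomsSchwinger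
import Literature.MathematicalPhysics.QuantumFieldTheory.OSData
import Literature.MathematicalPhysics.QuantumLattice.LatticeScalarField
import Literature.MathematicalPhysics.QuantumLattice.SchwartzNuclearExpansionBounds
import Literature.MathematicalPhysics.QuantumFieldTheory.LatticeGaugeStaticPotentialProofs
import Literature.Probability.LatticeModels.ThermodynamicLimit

/-!
# c1 blocks, wave 4, for the closure of line `conditional-mean-telescoping` (crux stmt-QuantumFields-8646)

Hypercubic and same-limit legs of (R) `ReflectionLegs` (seat -1's `PencilRigidityHypercubicLimitDefs.lean`):
(i) exact Θ-invariance of the RP-adapted lattice family; (ii) exact coordinate-permutation invariance of the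
toolkit's `latticeDist` of the curvature species; (iii) generation: a functional on `⁰𝒮ₙ` invariant under all
coordinate permutations and under the time reflection is invariant under every signed permutation of the axes;
(iv) the same-limit estimate under a SMEARED shifted uniform bound (the form `SoftData` hands to (R)): RP-adapted
sum over a sub-domain at shifted points minus canonical sum over the box is `O(a)`.  Def-free statements; each
`theorem` is registered (`workitem stub-add`) and proved in its own `--supports` file.
-/

noncomputable section

open scoped SchwartzMap ComplexConjugate
open MeasureTheory Filter Topology
open Literature.MathematicalPhysics.AQFT Literature.MathematicalPhysics.QuantumLattice
open Literature.MathematicalPhysics.QuantumFieldTheory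
open Literature.Probability.LatticeModels (box Site)
open Summit.QuantumFields.YangMills.Theorems.HypercubicLimit.Negative (torusPlaquette thetaZ)
open Summit.QuantumFields.YangMills.Theorems.OSLegsFromFemtoAndGap (latticeDist torusMoment)

namespace Summit.QuantumFields.YangMills.Cruxes.HypercubicLimit.ConditionalMeanTelescoping

/-- **Block Θ-INV (exact time-reflection invariance of the RP-adapted family).** For every test function
`F` (off-diagonal or not) the RP-adapted lattice `n`-point functional takes the same value on `F` and on
`Θ F` (`thetaMulti 4 F`, `(ΘF)(y) = F(θ y₁, …, θ yₙ)`): corner-reflection reindexing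
(`rpBlock_reflectSum`) + Θ-invariance of the torus state (`herm_moment_corner`). -/
theorem rpBlock_thetaInvariance :
    ∀ (G : Type) [Group G] [TopologicalSpace G] [IsTopologicalGroup G] [CompactSpace G]
      [MeasurableSpace G] [BorelSpace G] (r : LatticeRep G) (β : ℝ) (L : ℕ) (a lam : ℝ)
      (m : {q : Fin 4 × Fin 4 // q.1 < q.2} → ℝ) (n : ℕ) (F : 𝓢((Fin n → EuclideanSpace ℝ (Fin 4)), ℂ)),
      (∑ q : Fin n → {q : Fin 4 × Fin 4 // q.1 < q.2},
          ∑ x ∈ Fintype.piFinset (fun k => if (q k).1.1 = 0 then box 4 L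
              else (box 4 L).filter (fun y => 1 - (L : ℤ) ≤ y 0)),
            (((lam ^ n * ∫ U, ∏ k, (torusPlaquette r (2 * L + 1) (q k).1.1 (q k).1.2 (x k) U - m (q k))
                ∂(wilsonMeasure r.ρ β : Measure (GaugeConfig 4 (2 * L + 1) G)) : ℝ) : ℂ)) •
              LabelledSchwingerFamily.evalAt (fun k => a • (siteToE (x k) +
                (2⁻¹ : ℝ) • (EuclideanSpace.single (q k).1.1 (1 : ℝ) + EuclideanSpace.single (q k).1.2 (1 : ℝ)
                  - EuclideanSpace.single 0 (1 : ℝ))))) (thetaMulti 4 F) =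
      (∑ q : Fin n → {q : Fin 4 × Fin 4 // q.1 < q.2},
          ∑ x ∈ Fintype.piFinset (fun k => if (q k).1.1 = 0 then box 4 L
              else (box 4 L).filter (fun y => 1 - (L : ℤ) ≤ y 0)),
            (((lam ^ n * ∫ U, ∏ k, (torusPlaquette r (2 * L + 1) (q k).1.1 (q k).1.2 (x k) U - m (q k))
                ∂(wilsonMeasure r.ρ β : Measure (GaugeConfig 4 (2 * L + 1) G)) : ℝ) : ℂ)) •
              LabelledSchwingerFamily.evalAt (fun k => a • (siteToE (x k) +
                (2⁻¹ : ℝ) • (EuclideanSpace.single (q k).1.1 (1 : ℝ) + EuclideanSpace.single (q k).1.2 (1 : ℝ)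
                  - EuclideanSpace.single 0 (1 : ℝ))))) F := by
  sorry

/-- **Block PERM (exact coordinate-permutation invariance of the curvature's lattice distribution).** The
toolkit's `latticeDist` of `r.curvature.F` (any centring `M`) is invariant under the diagonal action of the
coordinate permutation `π` of `ℝ⁴` on test functions: the box and the set of the six plaquette orientations
are `π`-invariant, `Re tr ρ(U_p⁻¹) = Re tr ρ(U_p)`, and Wilson's torus measure is `configPerm`-invariant
(`rpBlock_momentPerm`). -/
theorem rpBlock_latticeDistPerm :
    ∀ (G : Type) [Group G] [TopologicalSpace G] [IsTopologicalGroup G] [CompactSpace G]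
      [MeasurableSpace G] [BorelSpace G] (r : LatticeRep G) (β : ℝ) (L : ℕ) (a M : ℝ) (n : ℕ)
      (π : Equiv.Perm (Fin 4)) (F : 𝓢((Fin n → EuclideanSpace ℝ (Fin 4)), ℂ)),
      latticeDist r.ρ β L a r.curvature.F M n
          (linActMulti (LinearIsometryEquiv.piLpCongrLeft 2 ℝ ℝ π) F) =
        latticeDist r.ρ β L a r.curvature.F M n F := by
  sorry

/-- **Block GEN (signed permutations are generated by permutations and the time reflection).** A
functional on `n`-point test functions which is invariant, on `⁰𝒮ₙ`, under the diagonal action of every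
coordinate permutation of `ℝ⁴` and under the diagonal time reflection `Θ` is invariant on `⁰𝒮ₙ` under the
diagonal action of every linear isometry mapping each coordinate axis to a signed coordinate axis (the
hyperoctahedral group; the crux only needs its determinant-one part). -/
theorem rpBlock_signedPermGeneration :
    ∀ (n : ℕ) (Φ : 𝓢((Fin n → EuclideanSpace ℝ (Fin 4)), ℂ) → ℂ),
      (∀ (π : Equiv.Perm (Fin 4)) (F : 𝓢((Fin n → EuclideanSpace ℝ (Fin 4)), ℂ)), IsOffDiagonal F →
        Φ (linActMulti (LinearIsometryEquiv.piLpCongrLeft 2 ℝ ℝ π) F) = Φ F) →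
      (∀ F : 𝓢((Fin n → EuclideanSpace ℝ (Fin 4)), ℂ), IsOffDiagonal F → Φ (thetaMulti 4 F) = Φ F) →
      ∀ R : EuclideanSpace ℝ (Fin 4) ≃ₗᵢ[ℝ] EuclideanSpace ℝ (Fin 4),
        (∀ i : Fin 4, ∃ j : Fin 4, R (EuclideanSpace.single i 1) = EuclideanSpace.single j 1 ∨
          R (EuclideanSpace.single i 1) = -EuclideanSpace.single j 1) →
        ∀ F : 𝓢((Fin n → EuclideanSpace ℝ (Fin 4)), ℂ), IsOffDiagonal F → Φ (linActMulti R F) = Φ F := by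
  sorry

/-- **Block SAME-LIMIT-SMEARED (RP-adapted minus canonical is `O(a)` under a smeared shifted uniform
bound).** For abstract real weights with sup bound `Mⁿ`, a sub-domain `D` of the box whose complement
lies in the far zone, a constant shift `c` with `‖c l‖ ≤ a ≤ 1`, `F ∈ ⁰𝒮ₙ`, and the SMEARED bound
`‖∑_{x ∈ box} W(x) G(y(x))‖ ≤ Φ |G|_s` for every `G ∈ ⁰𝒮ₙ` and every evaluation map `y` within `a` of the
scaled sites: `‖∑_{x∈D} W F(a x + c) − ∑_{x∈box} W F(a x)‖ ≤ a (2 Φ |F|_{s+1} + Mⁿ 2^{16n+2} Zⁿ 4^{10n+1} |F|_{10n+1})`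
(mean value theorem at intermediate points for real and imaginary parts, `∂_c F ∈ ⁰𝒮ₙ` with
`|∂_c F|_s ≤ ‖c‖ |F|_{s+1}`, plus `rpBlock_boundarySlice` for the translate `F(· + c)`). -/
theorem rpBlock_sameLimitSmeared :
    ∀ (n L s : ℕ) (M a Φ : ℝ) (W : (Fin n → Site 4) → ℝ) (D : Finset (Fin n → Site 4))
      (c : Fin n → EuclideanSpace ℝ (Fin 4)) (F : 𝓢((Fin n → EuclideanSpace ℝ (Fin 4)), ℂ)),
      0 ≤ M → (∀ x, |W x| ≤ M ^ n) → 0 < a → a ≤ 1 → a⁻¹ * a⁻¹ ≤ L → 0 ≤ Φ →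
      D ⊆ Fintype.piFinset (fun _ : Fin n => box 4 L) →
      (∀ x ∈ Fintype.piFinset (fun _ : Fin n => box 4 L), x ∉ D → ∃ l, (L : ℝ) ≤ ‖x l‖) →
      (∀ l, ‖c l‖ ≤ a) → IsOffDiagonal F →
      (∀ (y : (Fin n → Site 4) → (Fin n → EuclideanSpace ℝ (Fin 4))),
        (∀ x l, ‖y x l - a • siteToE (x l)‖ ≤ a) →
          ∀ G : 𝓢((Fin n → EuclideanSpace ℝ (Fin 4)), ℂ), IsOffDiagonal G →
            ‖∑ x ∈ Fintype.piFinset (fun _ : Fin n => box 4 L), ((W x : ℝ) : ℂ) * G (y x)‖ ≤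
              Φ * schwartzNorm s G) →
        ‖(∑ x ∈ D, ((W x : ℝ) : ℂ) * F (fun l => a • siteToE (x l) + c l)) -
            ∑ x ∈ Fintype.piFinset (fun _ : Fin n => box 4 L), ((W x : ℝ) : ℂ) * F (fun l => a • siteToE (x l))‖ ≤
          a * (2 * Φ * schwartzNorm (s + 1) F +
            M ^ n * 2 ^ (16 * n + 2) * (81 * ∑' j : ℕ, (((j : ℝ) + 1) ^ 2)⁻¹) ^ n * 4 ^ (10 * n + 1) *
              schwartzNorm (10 * n + 1) F) := by
  sorry

end Summit.QuantumFields.YangMills.Cruxes.HypercubicLimit.ConditionalMeanTelescoping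

end
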